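import Summits.QuantumFields.YangMills.Theorems.BalabanLadderUVSeamRecResponseMomentsPinning
import HarnessLib

/-!
# Crux `UVSeamRec` (stmt-QuantumFields-20043), v5(α) stub `stub_responseMomentsOdd6`: what the two currencies say about ONE
# cube's response TAIL — (RM) forces an exponential tail, (PM) only a Markov tail

Helper file (`--supports stmt-QuantumFields-20043`) of the stub-helper seat `ym-20043-seam-s2` (lane S-A, gen 2); the
quantitative form of the located remark of `…CeilingsProductMoments.lean` (p542286) «(RM) and (PM) differ exactly on heavy
tails», stated so that a disprover / a Monte-Carlo desk can TEST the registered binder on sampled exteriors: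

* `measureReal_ge_le_of_torusE_exp_le` — exponential Chebyshev on the odd torus: `⟨exp f⟩_{2L+1,β} ≤ e^B` ⇒
  `μ_{2L+1,β}{s ≤ f} ≤ e^{B − s}`; `measureReal_ge_le_of_torusE_one_add_le` — Markov: `⟨1 + f⟩ ≤ e^B`, `f ≥ 0` ⇒
  `μ{s ≤ f} ≤ e^B/(1 + s)`.
* **`measureReal_response_ge_le_of_responseMoments`** — under (RM) [`p`, `C₁`, `B`, `β₁`, `ℓ₁`], for `β ≥ β₁`, `1 ≤ R`,
  `R·a β ≤ ℓ₁`, `4R+8 ≤ L`, `q.1 < q.2`, every site `x` and every level `s`: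
  `μ_{2L+1,β}{U : s ≤ (R⁴/C₁)|kerE_{x−(R+1),2R+3}(plane q x)(lift U) − p q β|} ≤ exp(B − s)` — the law of the rescaled response
  has an EXPONENTIAL tail, uniformly in `R ≤ ℓ₁/a β` and in the torus side (so a response of size `κ/R⁴` must have
  μ-probability `≤ e^{B − κ/C₁}`, for all `κ` up to `≍ R⁴`).
* **`measureReal_response_ge_le_of_productMoments`** — under (PM) the same event only has the MARKOV bound `e^B/(1 + s)`.

HONEST FRAMING: necessary conditions of two OPEN currencies of a CONDITIONAL chain; nothing of E0′; not a gap, not Clay.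

References: Markov's inequality (Mathlib `mul_meas_ge_le_integral_of_nonneg`).
-/

set_option autoImplicit false

noncomputable section

open MeasureTheory Filter Topology Finset
open Literature.MathematicalPhysics.QuantumFieldTheory (GaugeConfig wilsonMeasure isProbabilityMeasure_wilsonMeasure
  LatticeRep)
open Literature.MathematicalPhysics.QuantumLattice
open Literature.Probability.LatticeModels
open Summit.QuantumFields.YangMills.Cruxes.OSLegsFromFemtoAndGap.DlrCollarTransfer
open Summit.QuantumFields.YangMills.Cruxes.UVSeamRec.TemperedResponse (continuous_kerE_plane)

namespace Summit.QuantumFields.YangMills.Cruxes.UVSeamRec.ResponsePinning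

variable {G : Type} [Group G] [TopologicalSpace G] [IsTopologicalGroup G] [CompactSpace G]
  [MeasurableSpace G] [BorelSpace G] (r : LatticeRep G)

/-! ## §1 Chebyshev and Markov on the odd torus -/

/-- **Exponential Chebyshev on the odd torus.**  For a continuous observable `f`: `⟨exp f⟩_{2L+1,β} ≤ e^B` ⇒ for every `s`,
`μ_{2L+1,β}{U : s ≤ f(lift U)} ≤ exp(B − s)`. [folklore: Markov] -/
theorem measureReal_ge_le_of_torusE_exp_le (β : ℝ) (L : ℕ) {f : LGConfig 4 G → ℝ} (hf : Continuous f) {B : ℝ}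
    (h : torusE G r β L (fun U => Real.exp (f U)) ≤ Real.exp B) (s : ℝ) :
    (wilsonMeasure (d := 4) (L := 2 * L + 1) r.ρ β).real
        {U : GaugeConfig 4 (2 * L + 1) G | s ≤ f (torusLift (2 * L + 1) U)} ≤ Real.exp (B - s) := by
  have hint : Integrable (fun U : GaugeConfig 4 (2 * L + 1) G => Real.exp (f (torusLift (2 * L + 1) U)))
      (wilsonMeasure (d := 4) (L := 2 * L + 1) r.ρ β) :=
    integrable_comp_lift r β L (F := fun y => Real.exp (f y)) (Real.continuous_exp.comp hf)
  have hmk := mul_meas_ge_le_integral_of_nonneg (μ := wilsonMeasure (d := 4) (L := 2 * L + 1) r.ρ β)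
    (Eventually.of_forall fun U => (Real.exp_pos (f (torusLift (2 * L + 1) U))).le) hint (Real.exp s)
  have hset : {U : GaugeConfig 4 (2 * L + 1) G | Real.exp s ≤ Real.exp (f (torusLift (2 * L + 1) U))} =
      {U | s ≤ f (torusLift (2 * L + 1) U)} := by
    ext U; simp only [Set.mem_setOf_eq, Real.exp_le_exp]
  rw [hset] at hmk
  have hE : ∫ U, Real.exp (f (torusLift (2 * L + 1) U)) ∂(wilsonMeasure (d := 4) (L := 2 * L + 1) r.ρ β) ≤
      Real.exp B := h
  rw [Real.exp_sub, le_div_iff₀ (Real.exp_pos s), mul_comm]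
  exact hmk.trans hE

/-- **Markov on the odd torus.**  For a continuous observable `f ≥ 0`: `⟨1 + f⟩_{2L+1,β} ≤ e^B` ⇒ for every `s ≥ 0`,
`μ_{2L+1,β}{U : s ≤ f(lift U)} ≤ e^B/(1 + s)`. [folklore: Markov] -/
theorem measureReal_ge_le_of_torusE_one_add_le (β : ℝ) (L : ℕ) {f : LGConfig 4 G → ℝ} (hf : Continuous f)
    (hf0 : ∀ U, 0 ≤ f U) {B : ℝ} (h : torusE G r β L (fun U => 1 + f U) ≤ Real.exp B) {s : ℝ} (hs : 0 ≤ s) :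
    (wilsonMeasure (d := 4) (L := 2 * L + 1) r.ρ β).real
        {U : GaugeConfig 4 (2 * L + 1) G | s ≤ f (torusLift (2 * L + 1) U)} ≤ Real.exp B / (1 + s) := by
  have hint : Integrable (fun U : GaugeConfig 4 (2 * L + 1) G => 1 + f (torusLift (2 * L + 1) U))
      (wilsonMeasure (d := 4) (L := 2 * L + 1) r.ρ β) :=
    integrable_comp_lift r β L (F := fun y => 1 + f y) (continuous_const.add hf)
  have hmk := mul_meas_ge_le_integral_of_nonneg (μ := wilsonMeasure (d := 4) (L := 2 * L + 1) r.ρ β)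
    (Eventually.of_forall fun U => by
      have := hf0 (torusLift (2 * L + 1) U)
      show (0 : ℝ) ≤ 1 + f (torusLift (2 * L + 1) U)
      linarith) hint (1 + s)
  have hset : {U : GaugeConfig 4 (2 * L + 1) G | 1 + s ≤ 1 + f (torusLift (2 * L + 1) U)} =
      {U | s ≤ f (torusLift (2 * L + 1) U)} := by
    ext U; simp only [Set.mem_setOf_eq, add_le_add_iff_left]
  rw [hset] at hmk
  have hE : ∫ U, (1 + f (torusLift (2 * L + 1) U)) ∂(wilsonMeasure (d := 4) (L := 2 * L + 1) r.ρ β) ≤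
      Real.exp B := h
  have h1s : 0 < 1 + s := by linarith
  rw [le_div_iff₀ h1s, mul_comm]
  exact hmk.trans hE

/-! ## §2 The response tail under (RM) and under (PM) -/

section Tails

variable (a : ℝ → ℝ)

/-- **(RM) forces an exponential response tail.**  Under (RM) at unit `a` [`p`, `C₁`, `B`, `β₁`, `ℓ₁`] (the `hRM` of
p532025 VERBATIM): for `β ≥ β₁`, `1 ≤ R`, `R·a β ≤ ℓ₁`, `4R+8 ≤ L`, `q.1 < q.2`, every site `x` and every level `s`,
`μ_{2L+1,β}{U : s ≤ (R⁴/C₁)|kerE_{x−(R+1),2R+3}(plane q x)(lift U) − p q β|} ≤ exp(B − s)`.  A response of size `κ/R⁴` is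
thus an event of probability `≤ e^{B − κ/C₁}` — for EVERY `κ` up to the a-priori maximum `≍ R⁴`, uniformly in the torus. [folklore] -/
theorem measureReal_response_ge_le_of_responseMoments {C₁ B β₁ ℓ₁ : ℝ} {p : Fin 4 × Fin 4 → ℝ → ℝ}
    (hRM : ∀ β : ℝ, β₁ ≤ β → ∀ (L n : ℕ) (q : Fin n → Fin 4 × Fin 4) (x : Fin n → (Fin 4 → ℤ)) (R : ℕ),
      (∀ i, (q i).1 < (q i).2) → 1 ≤ R → (R : ℝ) * a β ≤ ℓ₁ → 4 * R + 8 ≤ L →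
      (∀ i j : Fin n, i ≠ j → ∃ k : Fin 4,
        (2 * (R : ℤ) + 4) ≤ |((((x i k - x j k : ℤ) : ZMod (2 * L + 1))).valMinAbs : ℤ)|) →
      ∀ T : Finset (Fin n),
        torusE G r β L (fun U => Real.exp (∑ i ∈ T, (R : ℝ) ^ 4 / C₁ *
          |kerE G r β (fun k => x i k - (R + 1)) (2 * R + 3) U (plane G r (q i) (x i)) - p (q i) β|)) ≤
          Real.exp (B * T.card))
    {β : ℝ} (hβ : β₁ ≤ β) {L R : ℕ} (q : Fin 4 × Fin 4) (x : Fin 4 → ℤ) (hq : q.1 < q.2) (hR : 1 ≤ R)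
    (hRa : (R : ℝ) * a β ≤ ℓ₁) (hRL : 4 * R + 8 ≤ L) (s : ℝ) :
    (wilsonMeasure (d := 4) (L := 2 * L + 1) r.ρ β).real
        {U : GaugeConfig 4 (2 * L + 1) G | s ≤ (R : ℝ) ^ 4 / C₁ *
          |kerE G r β (fun k => x k - (R + 1)) (2 * R + 3) (torusLift (2 * L + 1) U) (plane G r q x) - p q β|} ≤
      Real.exp (B - s) := by
  have h1 := hRM β hβ L 1 (fun _ => q) (fun _ => x) R (fun _ => hq) hR hRa hRL
    (fun i j hij => absurd (Subsingleton.elim i j) hij) Finset.univ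
  simp only [Finset.univ_unique, Finset.sum_singleton, Finset.card_singleton, Nat.cast_one, mul_one] at h1
  exact measureReal_ge_le_of_torusE_exp_le r β L
    (continuous_const.mul ((continuous_kerE_plane r β _ _ q x).sub continuous_const).abs) h1 s

/-- **(PM) only forces a Markov response tail.**  Under the product currency (PM) of `…CeilingsProductMoments` at unit `a`
[`p`, `C₁ > 0`, `B`, `β₁`, `ℓ₁`], on the same guards and for every `s ≥ 0`:
`μ_{2L+1,β}{U : s ≤ (R⁴/C₁)|kerE(plane q x)(lift U) − p q β|} ≤ e^B/(1 + s)`.  This is where the two currencies part: a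
response tail `μ{· ≥ s} ≍ e^B/(1+s)²`, say, satisfies every (PM) singleton bound and violates (RM). [folklore] -/
theorem measureReal_response_ge_le_of_productMoments {C₁ B β₁ ℓ₁ : ℝ} {p : Fin 4 × Fin 4 → ℝ → ℝ} (hC₁ : 0 < C₁)
    (hPM : ∀ β : ℝ, β₁ ≤ β → ∀ (L n : ℕ) (q : Fin n → Fin 4 × Fin 4) (x : Fin n → (Fin 4 → ℤ)) (R : ℕ),
      (∀ i, (q i).1 < (q i).2) → 1 ≤ R → (R : ℝ) * a β ≤ ℓ₁ → 4 * R + 8 ≤ L →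
      (∀ i j : Fin n, i ≠ j → ∃ k : Fin 4,
        (2 * (R : ℤ) + 4) ≤ |((((x i k - x j k : ℤ) : ZMod (2 * L + 1))).valMinAbs : ℤ)|) →
      ∀ T : Finset (Fin n),
        torusE G r β L (fun U => ∏ i ∈ T, (1 + (R : ℝ) ^ 4 / C₁ *
          |kerE G r β (fun k => x i k - (R + 1)) (2 * R + 3) U (plane G r (q i) (x i)) - p (q i) β|)) ≤
          Real.exp (B * T.card))
    {β : ℝ} (hβ : β₁ ≤ β) {L R : ℕ} (q : Fin 4 × Fin 4) (x : Fin 4 → ℤ) (hq : q.1 < q.2) (hR : 1 ≤ R)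
    (hRa : (R : ℝ) * a β ≤ ℓ₁) (hRL : 4 * R + 8 ≤ L) {s : ℝ} (hs : 0 ≤ s) :
    (wilsonMeasure (d := 4) (L := 2 * L + 1) r.ρ β).real
        {U : GaugeConfig 4 (2 * L + 1) G | s ≤ (R : ℝ) ^ 4 / C₁ *
          |kerE G r β (fun k => x k - (R + 1)) (2 * R + 3) (torusLift (2 * L + 1) U) (plane G r q x) - p q β|} ≤
      Real.exp B / (1 + s) := by
  have h1 := hPM β hβ L 1 (fun _ => q) (fun _ => x) R (fun _ => hq) hR hRa hRL
    (fun i j hij => absurd (Subsingleton.elim i j) hij) Finset.univ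
  simp only [Finset.univ_unique, Finset.prod_singleton, Finset.card_singleton, Nat.cast_one, mul_one] at h1
  have hR0 : (0 : ℝ) ≤ (R : ℝ) ^ 4 / C₁ := by positivity
  exact measureReal_ge_le_of_torusE_one_add_le r β L
    (continuous_const.mul ((continuous_kerE_plane r β _ _ q x).sub continuous_const).abs)
    (fun U => mul_nonneg hR0 (abs_nonneg _)) h1 hs

end Tails

end Summit.QuantumFields.YangMills.Cruxes.UVSeamRec.ResponsePinning

end
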